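import Literature.Topology.PlaneTopology.EilenbergCriterion
import Literature.Topology.PlaneTopology.JordanCurveProofs
import Mathlib.Analysis.Complex.Basic
import Mathlib.Analysis.SpecialFunctions.Complex.Arg
import Mathlib.Topology.OpenPartialHomeomorph.Basic
import HarnessLib

/-!
# The orientation parity of a planar chart

Topic: Topology / PlaneTopology. Let `X` be a space openly embedded in the plane by `ι : X → ℂ`
(an open subset of `ℂ`, of `ℝ × ℝ`, …) and `e` a chart of `X` onto the whole model plane,
`e : OpenPartialHomeomorph X (ℝ × ℝ)` with `e.target = univ` (the flow boxes of the `C⁰`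
foliations of `Literature/Topology/FourManifolds/TautFoliations*.lean` are of this kind). The
chart is either orientation preserving or orientation reversing, and in class `C⁰` this is
read off a winding number: the **parity** of `e` at `x ∈ e.source` is the winding number about
`ι x` of the image under `ι ∘ e.symm` of the unit circle of the model plane about `e x`
(`parity`). We prove:

* `wind_eq_of_homotopy` (**proved**, [folklore]): homotopic loops in `ℂ \ {0}` have the same
  winding number (Rouché's principle `wind_eq_of_norm_sub_lt` of `WindingNumber.lean` in
  small steps of the parameter, by uniform continuity);
* `wind_chartLoop_sub` (**proved**): the parity does not depend on the radius of the circle;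
* `eventually_parity_eq`, `parity_eq_parity` (**proved**): the parity is locally constant in
  `x`, hence constant on the (connected) source of the chart;
* `parity_ne_zero` (**proved**): the parity is non-zero. The image circle `J` is a Jordan
  curve (`JordanCurveTheorem_holds` of the tree), with bounded complementary component `U`.
  Points off `ι (e.source)` have winding number `0` (shrink the circle in the chart), points
  of `U` have non-zero winding number (Eilenberg's criterion `not_hasLogOn_sub` of
  `EilenbergCriterion.lean`, read through `hasLogOn_iff_wind_eq_zero`), so `U ⊆ ι (e.source)`;
  then `U` lies in the image of the open unit disc or of the exterior of the closed disc, and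
  having frontier `J` it is all of one of them (clopen argument in the chart); the exterior is
  excluded (it is not relatively compact in the chart), so `ι x ∈ U` and its winding number is
  non-zero.

This is the `C⁰` substitute for the sign of the Jacobian determinant; it orients the leaves
of transversely oriented foliations of planar domains (`Literature/Topology/PlanarFoliations/`).
All statements are [folklore] (method: Eilenberg 1936; McCleary 2006, Ch. 9).
-/

noncomputable section

open Set Filter Metric Function Complex Bornology
open _root_.Topology
open scoped Real

namespace Literature.Topology.PlaneTopology

/-! ## Homotopy invariance of the winding number -/

/-- **Homotopic loops in `ℂ \ {0}` have the same winding number**: for a jointly continuous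
family `H s` (`s ∈ [0, 1]`) of loops (`H s 0 = H s 1`) nonvanishing on `[0, 1]`,
`wind (H 0) = wind (H 1)`. By uniform continuity on the compact square, parameters closer
than some `δ` give loops closer than `min ‖H‖`, which have the same winding number by Rouché's
principle (`wind_eq_of_norm_sub_lt`); chain from `0` to `1` in steps `< δ`. [folklore] -/
theorem wind_eq_of_homotopy {H : ℝ → ℝ → ℂ} (hH : ContinuousOn (uncurry H) (Icc 0 1 ×ˢ Icc 0 1))
    (hloop : ∀ s ∈ Icc (0 : ℝ) 1, H s 0 = H s 1) (hne : ∀ s ∈ Icc (0 : ℝ) 1, ∀ t ∈ Icc (0 : ℝ) 1, H s t ≠ 0) :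
    wind (H 0) = wind (H 1) := by
  have hK : IsCompact (Icc (0 : ℝ) 1 ×ˢ Icc (0 : ℝ) 1) := isCompact_Icc.prod isCompact_Icc
  -- a positive lower bound of `‖H‖` on the square
  obtain ⟨p₀, hp₀, hmin⟩ := hK.exists_isMinOn ⟨(0, 0), ⟨left_mem_Icc.2 zero_le_one, left_mem_Icc.2 zero_le_one⟩⟩
    (continuous_norm.comp_continuousOn hH)
  set m : ℝ := ‖uncurry H p₀‖ with hm
  have hm₀ : 0 < m := norm_pos_iff.2 (hne p₀.1 hp₀.1 p₀.2 hp₀.2)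
  -- a modulus of uniform continuity for `m`
  obtain ⟨δ, hδ, hδH⟩ := Metric.uniformContinuousOn_iff.1 (hK.uniformContinuousOn_of_continuous hH) m hm₀
  have hcont : ∀ s ∈ Icc (0 : ℝ) 1, ContinuousOn (H s) (Icc 0 1) := fun s hs ↦
    hH.comp (continuousOn_const.prodMk continuousOn_id) fun t ht ↦ ⟨hs, ht⟩
  -- one step
  have hstep : ∀ s ∈ Icc (0 : ℝ) 1, ∀ s' ∈ Icc (0 : ℝ) 1, dist s s' < δ → wind (H s) = wind (H s') := by
    intro s hs s' hs' hd
    refine wind_eq_of_norm_sub_lt (hcont s hs) (hloop s hs) ⟨hcont s' hs', hne s' hs', hloop s' hs'⟩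
      fun t ht ↦ ?_
    have h1 : dist (H s t) (H s' t) < m := by
      have hd' : dist (s, t) (s', t) < δ := by
        rw [Prod.dist_eq, dist_self]
        exact max_lt hd hδ
      exact hδH (s, t) ⟨hs, ht⟩ (s', t) ⟨hs', ht⟩ hd'
    have h2 : m ≤ ‖H s' t‖ := hmin (show (s', t) ∈ Icc (0 : ℝ) 1 ×ˢ Icc (0 : ℝ) 1 from ⟨hs', ht⟩)
    rw [dist_eq_norm] at h1
    linarith
  -- chain from `0` to `1`
  obtain ⟨N, hN⟩ := exists_nat_gt (1 / δ)
  have hN₀ : (0 : ℝ) < N := lt_trans (by positivity) hN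
  have hNδ : 1 / (N : ℝ) < δ := by
    rw [div_lt_iff₀ hN₀]
    rw [div_lt_iff₀ hδ] at hN
    linarith
  have hmem : ∀ k : ℕ, k ≤ N → ((k : ℝ) / N) ∈ Icc (0 : ℝ) 1 := fun k hk ↦
    ⟨by positivity, by rw [div_le_one hN₀]; exact_mod_cast hk⟩
  have hchain : ∀ k : ℕ, k ≤ N → wind (H ((k : ℝ) / N)) = wind (H 0) := by
    intro k
    induction k with
    | zero => intro; simp
    | succ k ih =>
      intro hk
      rw [← ih (Nat.le_of_succ_le hk)]
      refine hstep _ (hmem _ hk) _ (hmem _ (Nat.le_of_succ_le hk)) ?_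
      rw [Real.dist_eq, Nat.cast_succ, show ((k : ℝ) + 1) / N - k / N = 1 / N by ring,
        abs_of_pos (by positivity)]
      exact hNδ
  have hNN : (N : ℝ) ≠ 0 := hN₀.ne'
  have := hchain N le_rfl
  rw [div_self hNN] at this
  exact this.symm

/-- A loop that shrinks to a non-zero constant through nonvanishing loops has winding number
`0`. [folklore] -/
theorem wind_eq_zero_of_homotopy_const {H : ℝ → ℝ → ℂ} (hH : ContinuousOn (uncurry H) (Icc 0 1 ×ˢ Icc 0 1))
    (hloop : ∀ s ∈ Icc (0 : ℝ) 1, H s 0 = H s 1) (hne : ∀ s ∈ Icc (0 : ℝ) 1, ∀ t ∈ Icc (0 : ℝ) 1, H s t ≠ 0)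
    {c : ℂ} (h1 : ∀ t, H 1 t = c) : wind (H 0) = 0 := by
  rw [wind_eq_of_homotopy hH hloop hne, show H 1 = fun _ ↦ c from funext h1, wind_const]

/-! ## A homeomorphism `ℝ/ℤ ≃ₜ range γ` through which `γ` factors -/

/-- A continuous `1`-periodic loop injective on `[0, 1)` factors through a homeomorphism of
`ℝ/ℤ` onto its range that agrees with the loop on `[0, 1]` (compare
`range_homeomorphic_addCircle`, which only records the existence of a homeomorphism).
[folklore] -/
theorem exists_homeomorph_addCircle_forall_eq {γ : ℝ → ℂ} (hγ : Continuous γ) (hp : Function.Periodic γ 1)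
    (hinj : InjOn γ (Ico 0 1)) :
    ∃ f : AddCircle (1 : ℝ) ≃ₜ range γ, ∀ t ∈ Icc (0 : ℝ) 1, (f (t : AddCircle (1 : ℝ)) : ℂ) = γ t := by
  haveI : Fact ((0 : ℝ) < 1) := ⟨one_pos⟩
  set f : AddCircle (1 : ℝ) → ℂ := AddCircle.liftIco 1 0 γ with hf
  have hfc : Continuous f := AddCircle.liftIco_zero_continuous (by simpa using (hp 0).symm)
    hγ.continuousOn
  have hfapply : ∀ x : ℝ, x ∈ Ico (0 : ℝ) 1 → f (x : AddCircle (1 : ℝ)) = γ x := fun x hx ↦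
    AddCircle.liftIco_coe_apply (by simpa using hx)
  have hfinj : Function.Injective f := by
    intro a b hab
    obtain ⟨x, hx, rfl⟩ : ∃ x ∈ Ico (0 : ℝ) 1, (x : AddCircle (1 : ℝ)) = a :=
      ⟨(AddCircle.equivIco 1 0 a : ℝ), by simpa using (AddCircle.equivIco 1 0 a).2,
        AddCircle.coe_equivIco⟩
    obtain ⟨y, hy, rfl⟩ : ∃ y ∈ Ico (0 : ℝ) 1, (y : AddCircle (1 : ℝ)) = b :=
      ⟨(AddCircle.equivIco 1 0 b : ℝ), by simpa using (AddCircle.equivIco 1 0 b).2,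
        AddCircle.coe_equivIco⟩
    rw [hfapply x hx, hfapply y hy] at hab
    rw [hinj hx hy hab]
  have hrange : range f = range γ := by
    ext z
    constructor
    · rintro ⟨a, rfl⟩
      obtain ⟨x, hx, rfl⟩ : ∃ x ∈ Ico (0 : ℝ) 1, (x : AddCircle (1 : ℝ)) = a :=
        ⟨(AddCircle.equivIco 1 0 a : ℝ), by simpa using (AddCircle.equivIco 1 0 a).2,
          AddCircle.coe_equivIco⟩
      exact ⟨x, (hfapply x hx).symm⟩
    · rintro ⟨t, rfl⟩
      obtain ⟨x, hx, hxt⟩ := hp.exists_mem_Ico₀ one_pos t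
      exact ⟨(x : AddCircle (1 : ℝ)), by rw [hfapply x hx, ← hxt]⟩
  have hemb : Topology.IsEmbedding f := (hfc.isClosedEmbedding hfinj).isEmbedding
  refine ⟨hemb.toHomeomorph.trans (Homeomorph.setCongr hrange), fun t ht ↦ ?_⟩
  rcases ht.2.eq_or_lt with rfl | h1
  · -- `t = 1`: the class of `1` is the class of `0`
    have h10 : ((1 : ℝ) : AddCircle (1 : ℝ)) = ((0 : ℝ) : AddCircle (1 : ℝ)) := by
      rw [AddCircle.coe_period, QuotientAddGroup.mk_zero]
    show f ((1 : ℝ) : AddCircle (1 : ℝ)) = γ 1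
    rw [h10, hfapply 0 ⟨le_rfl, one_pos⟩]
    have := hp 0
    rw [zero_add] at this
    exact this.symm
  · show f (t : AddCircle (1 : ℝ)) = γ t
    exact hfapply t ⟨ht.1, h1⟩

/-- **Winding number and logarithms on a Jordan curve**: for a Jordan loop `γ` (continuous,
`1`-periodic, injective on `[0, 1)`) and `a` off its range, `z ↦ z - a` has a continuous
logarithm on the curve iff `wind (γ - a) = 0` (the bridge `hasLogOn_iff_wind_eq_zero` of
`JordanCurveProofs.lean`, transported along the factorisation of `γ` through `ℝ/ℤ`).
[folklore] -/
theorem hasLogOn_sub_range_iff_wind_eq_zero {γ : ℝ → ℂ} (hγ : Continuous γ) (hp : Function.Periodic γ 1)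
    (hinj : InjOn γ (Ico 0 1)) {a : ℂ} (ha : a ∉ range γ) :
    HasLogOn (fun z ↦ z - a) (range γ) ↔ wind (fun t ↦ γ t - a) = 0 := by
  obtain ⟨f, hf⟩ := exists_homeomorph_addCircle_forall_eq hγ hp hinj
  have h0 : ∀ z ∈ range γ, z - a ≠ 0 := fun z hz h ↦ ha (by rwa [sub_eq_zero.1 h] at hz)
  rw [JordanCurveProof.hasLogOn_iff_wind_eq_zero f (F := fun z ↦ z - a) (by fun_prop) h0,
    wind_congr (g := fun t ↦ γ t - a)]
  intro t ht
  show (f (t : AddCircle (1 : ℝ)) : ℂ) - a = γ t - a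
  rw [hf t ht]

/-! ## The chart loop and the parity -/

section Parity

variable {X : Type*} [TopologicalSpace X] (ι : X → ℂ) (e : OpenPartialHomeomorph X (ℝ × ℝ))

/-- Real coordinates of the plane, as a homeomorphism `ℂ ≃ₜ ℝ × ℝ`. [folklore] -/
def toRR : ℂ ≃ₜ ℝ × ℝ := Complex.equivRealProdCLM.toHomeomorph

/-- `toRR z = (re z, im z)`. [folklore] -/
@[simp] theorem toRR_apply (z : ℂ) : toRR z = (z.re, z.im) := rfl

/-- The **complexified inverse chart** `ℂ → ℂ`, `z ↦ ι (e.symm (re z, im z))`. [folklore] -/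
def cplxInv (z : ℂ) : ℂ := ι (e.symm (toRR z))

/-- The **centre** of the chart loops about `x`: the complex number with real coordinates
`e x`. [folklore] -/
def center (x : X) : ℂ := toRR.symm (e x)

/-- The **chart loop** of radius `ρ` about `x`: the image under the complexified inverse chart
of the circle of radius `ρ` about the centre. [folklore] -/
def chartLoop (x : X) (ρ : ℝ) (t : ℝ) : ℂ := cplxInv ι e (circleLoop (center e x) ρ t)

/-- The **parity** of the chart `e` at `x` (in the planar embedding `ι`): the winding number
about `ι x` of the chart loop of radius `1` about `x`. [folklore] -/
def parity (x : X) : ℤ := wind fun t ↦ chartLoop ι e x 1 t - ι x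

variable {ι e} {x : X} {ρ : ℝ}

/-- `toRR (center e x) = e x`. [folklore] -/
@[simp] theorem toRR_center (x : X) : toRR (center e x) = e x := toRR.apply_symm_apply _

/-- The real part of the centre is the leaf coordinate. [folklore] -/
@[simp] theorem center_re (x : X) : (center e x).re = (e x).1 := congrArg Prod.fst (toRR_center (e := e) x)

/-- The imaginary part of the centre is the height. [folklore] -/
@[simp] theorem center_im (x : X) : (center e x).im = (e x).2 := congrArg Prod.snd (toRR_center (e := e) x)

/-- Circle loops in real coordinates. [folklore] -/
theorem toRR_circleLoop (c : ℂ) (ρ θ : ℝ) :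
    toRR (circleLoop c ρ θ) = (c.re + ρ * Real.cos (2 * π * θ), c.im + ρ * Real.sin (2 * π * θ)) := by
  rw [circleLoop_apply, show (2 * π * θ * I : ℂ) = ((2 * π * θ : ℝ) : ℂ) * I by push_cast; ring,
    toRR_apply, Complex.add_re, Complex.add_im, Complex.re_ofReal_mul, Complex.im_ofReal_mul,
    Complex.exp_ofReal_mul_I_re, Complex.exp_ofReal_mul_I_im]

/-- **The chart loop in coordinates**: `ι (e.symm (u₀ + ρ cos 2πθ, t₀ + ρ sin 2πθ))` with
`(u₀, t₀) = e x`. [folklore] -/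
theorem chartLoop_eq (x : X) (ρ θ : ℝ) : chartLoop ι e x ρ θ =
    ι (e.symm ((e x).1 + ρ * Real.cos (2 * π * θ), (e x).2 + ρ * Real.sin (2 * π * θ))) := by
  show ι (e.symm (toRR (circleLoop (center e x) ρ θ))) = _
  rw [toRR_circleLoop, center_re, center_im]

/-- The complexified inverse chart is continuous (for a chart onto the whole model plane).
[folklore] -/
theorem continuous_cplxInv (hι : Continuous ι) (he : e.target = univ) : Continuous (cplxInv ι e) := by
  have hs : Continuous e.symm := by
    have := e.continuousOn_symm
    rw [he, continuousOn_univ] at this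
    exact this
  exact hι.comp (hs.comp toRR.continuous)

/-- The complexified inverse chart is injective (for an injective `ι`). [folklore] -/
theorem injective_cplxInv (hι : Injective ι) (he : e.target = univ) : Injective (cplxInv ι e) := by
  intro z w h
  have h' : e.symm (toRR z) = e.symm (toRR w) := hι h
  have hz : toRR z ∈ e.symm.source := by rw [e.symm_source, he]; exact mem_univ _
  have hw : toRR w ∈ e.symm.source := by rw [e.symm_source, he]; exact mem_univ _
  exact toRR.injective (e.symm.injOn hz hw h')

/-- The complexified inverse chart at the centre is `ι x`. [folklore] -/
theorem cplxInv_center (hx : x ∈ e.source) : cplxInv ι e (center e x) = ι x := by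
  show ι (e.symm (toRR (center e x))) = ι x
  rw [toRR_center, e.left_inv hx]

/-- The range of the complexified inverse chart is `ι (e.source)`. [folklore] -/
theorem range_cplxInv (he : e.target = univ) : range (cplxInv ι e) = ι '' e.source := by
  ext z
  constructor
  · rintro ⟨w, rfl⟩
    exact mem_image_of_mem ι (e.map_target (by rw [he]; exact mem_univ _))
  · rintro ⟨y, hy, rfl⟩
    refine ⟨toRR.symm (e y), ?_⟩
    show ι (e.symm (toRR (toRR.symm (e y)))) = ι y
    rw [toRR.apply_symm_apply, e.left_inv hy]

/-- The complexified inverse chart is an open map. [folklore] -/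
theorem isOpenMap_cplxInv (hι : IsOpenEmbedding ι) (he : e.target = univ) : IsOpenMap (cplxInv ι e) := by
  intro W hW
  have h1 : IsOpen (toRR '' W) := toRR.isOpenMap W hW
  have h2 : IsOpen (e.symm '' (toRR '' W)) :=
    e.symm.isOpen_image_of_subset_source h1 (by rw [e.symm_source, he]; exact subset_univ _)
  have h3 := hι.isOpenMap _ h2
  have : cplxInv ι e '' W = ι '' (e.symm '' (toRR '' W)) := by
    simp only [image_image]
    rfl
  rwa [this]

/-- The chart loop is continuous. [folklore] -/
theorem continuous_chartLoop (hι : Continuous ι) (he : e.target = univ) (x : X) (ρ : ℝ) :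
    Continuous (chartLoop ι e x ρ) :=
  (continuous_cplxInv hι he).comp (continuous_circleLoop _ _)

/-- The chart loop is a loop on `[0, 1]`. [folklore] -/
theorem chartLoop_zero (x : X) (ρ : ℝ) : chartLoop ι e x ρ 0 = chartLoop ι e x ρ 1 := by
  simp only [chartLoop, circleLoop_zero_eq]

/-- The chart loop is `1`-periodic. [folklore] -/
theorem periodic_chartLoop (x : X) (ρ : ℝ) : Function.Periodic (chartLoop ι e x ρ) 1 := fun t ↦ by
  show cplxInv ι e (circleMap (center e x) ρ (2 * π * (t + 1))) =
    cplxInv ι e (circleMap (center e x) ρ (2 * π * t))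
  rw [mul_add, mul_one, periodic_circleMap]

/-- The chart loop of non-zero radius avoids `ι x`. [folklore] -/
theorem chartLoop_ne (hι : Injective ι) (he : e.target = univ) (hx : x ∈ e.source) (hρ : ρ ≠ 0) (t : ℝ) :
    chartLoop ι e x ρ t ≠ ι x := by
  rw [← cplxInv_center (ι := ι) hx]
  intro h
  have h' := injective_cplxInv hι he h
  have hn := norm_circleLoop_sub_center (center e x) ρ t
  rw [h', sub_self, norm_zero] at hn
  exact hρ (abs_eq_zero.1 hn.symm)

/-- The chart loop of non-zero radius, minus `ι x`, is a loop in `ℂ \ {0}`. [folklore] -/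
theorem isNonvanishingLoop_chartLoop_sub (hιc : Continuous ι) (hι : Injective ι) (he : e.target = univ)
    (hx : x ∈ e.source) (hρ : ρ ≠ 0) : IsNonvanishingLoop fun t ↦ chartLoop ι e x ρ t - ι x :=
  ⟨((continuous_chartLoop hιc he x ρ).sub continuous_const).continuousOn,
    fun t _ ↦ sub_ne_zero.2 (chartLoop_ne hι he hx hρ t), by simp only [chartLoop_zero]⟩

/-- The chart loop is injective on `[0, 1)` (non-zero radius). [folklore] -/
theorem injOn_chartLoop (hι : Injective ι) (he : e.target = univ) (x : X) (hρ : ρ ≠ 0) :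
    InjOn (chartLoop ι e x ρ) (Ico 0 1) := by
  intro s hs t ht h
  have h' : circleMap (center e x) ρ (2 * π * s) = circleMap (center e x) ρ (2 * π * t) :=
    injective_cplxInv hι he h
  have hinj := injOn_circleMap_of_abs_sub_le' (c := center e x) (a := 0) (b := 2 * π) hρ (by linarith)
  have hs' : 2 * π * s ∈ Ico 0 (2 * π) := ⟨by nlinarith [hs.1, Real.pi_pos], by nlinarith [hs.2, Real.pi_pos]⟩
  have ht' : 2 * π * t ∈ Ico 0 (2 * π) := ⟨by nlinarith [ht.1, Real.pi_pos], by nlinarith [ht.2, Real.pi_pos]⟩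
  have := hinj hs' ht' h'
  nlinarith [Real.pi_pos]

/-- Joint continuity of the chart loops in the point, the radius and the parameter: for
maps `f` (into the source), `r`, `τ` continuous on `s`, `y ↦ chartLoop (f y) (r y) (τ y)` is
continuous on `s`. [folklore] -/
theorem continuousOn_chartLoop_comp (hιc : Continuous ι) (he : e.target = univ) {Y : Type*} [TopologicalSpace Y]
    {f : Y → X} {r τ : Y → ℝ} {s : Set Y} (hf : ContinuousOn f s) (hfs : MapsTo f s e.source)
    (hr : ContinuousOn r s) (hτ : ContinuousOn τ s) :
    ContinuousOn (fun y ↦ chartLoop ι e (f y) (r y) (τ y)) s := by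
  have hc : ContinuousOn (fun y ↦ center e (f y)) s :=
    toRR.symm.continuous.comp_continuousOn (e.continuousOn.comp hf hfs)
  have key : (fun y ↦ chartLoop ι e (f y) (r y) (τ y)) =
      cplxInv ι e ∘ fun y ↦ center e (f y) + (r y : ℂ) * Complex.exp (2 * π * (τ y : ℂ) * I) := by
    funext y
    simp only [comp_apply, chartLoop, circleLoop_apply]
  rw [key]
  refine (continuous_cplxInv hιc he).comp_continuousOn (hc.add (ContinuousOn.mul ?_ ?_))
  · exact Complex.continuous_ofReal.comp_continuousOn hr
  · refine Complex.continuous_exp.comp_continuousOn ?_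
    exact ((continuousOn_const.mul (Complex.continuous_ofReal.comp_continuousOn hτ)).mul continuousOn_const)

/-! ## Independence of the radius, local constancy -/

/-- **The parity can be computed with any positive radius.** [folklore] -/
theorem wind_chartLoop_sub (hιc : Continuous ι) (hι : Injective ι) (he : e.target = univ) (hx : x ∈ e.source)
    (hρ : 0 < ρ) : wind (fun t ↦ chartLoop ι e x ρ t - ι x) = parity ι e x := by
  -- homotopy of the radius from `ρ` to `1`
  have hrad : ∀ s ∈ Icc (0 : ℝ) 1, 0 < (1 - s) * ρ + s := fun s hs ↦ by
    rcases hs.1.eq_or_lt with h | h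
    · rw [← h]; simpa using hρ
    · nlinarith [hs.2]
  have h := wind_eq_of_homotopy (H := fun s t ↦ chartLoop ι e x ((1 - s) * ρ + s) t - ι x) ?_
    (fun s _ ↦ by simp only [chartLoop_zero]) fun s hs t _ ↦ sub_ne_zero.2
      (chartLoop_ne hι he hx (hrad s hs).ne' t)
  · simp only [sub_zero, one_mul, add_zero, sub_self, zero_mul, zero_add] at h
    exact h
  · refine ContinuousOn.sub ?_ continuousOn_const
    exact continuousOn_chartLoop_comp hιc he continuousOn_const (fun _ _ ↦ hx) (by fun_prop) (by fun_prop)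

/-- **The parity is locally constant in the point.** [folklore] -/
theorem eventually_parity_eq (hιc : Continuous ι) (hι : Injective ι) (he : e.target = univ) {x₀ : X}
    (hx₀ : x₀ ∈ e.source) : ∀ᶠ x in 𝓝 x₀, parity ι e x = parity ι e x₀ := by
  have hg : IsNonvanishingLoop (fun t ↦ chartLoop ι e x₀ 1 t - ι x₀) :=
    isNonvanishingLoop_chartLoop_sub hιc hι he hx₀ one_ne_zero
  -- a positive lower bound of the loop at `x₀`
  obtain ⟨t₀, ht₀, hmin⟩ := isCompact_Icc.exists_isMinOn (nonempty_Icc.2 (zero_le_one (α := ℝ)))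
    (continuous_norm.comp_continuousOn hg.continuousOn)
  have hm₀ : 0 < ‖chartLoop ι e x₀ 1 t₀ - ι x₀‖ := norm_pos_iff.2 (hg.ne_zero t₀ ht₀)
  -- joint continuity on `e.source × ℝ`
  have hLc : ContinuousOn (fun p : X × ℝ ↦ chartLoop ι e p.1 1 p.2 - ι p.1) (e.source ×ˢ univ) := by
    have h₁ : ContinuousOn (fun p : X × ℝ ↦ chartLoop ι e p.1 1 p.2) (e.source ×ˢ univ) :=
      continuousOn_chartLoop_comp hιc he continuousOn_fst (fun p hp ↦ hp.1) continuousOn_const continuousOn_snd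
    have h₂ : ContinuousOn (fun p : X × ℝ ↦ ι p.1) (e.source ×ˢ univ) := (hιc.comp continuous_fst).continuousOn
    exact h₁.sub h₂
  have hP : ∀ t ∈ Icc (0 : ℝ) 1, ∀ᶠ z : X × ℝ in 𝓝 (x₀, t),
      ‖(chartLoop ι e z.1 1 z.2 - ι z.1) - (chartLoop ι e x₀ 1 z.2 - ι x₀)‖ <
        ‖chartLoop ι e x₀ 1 t₀ - ι x₀‖ := by
    intro t _
    have hca : ContinuousAt (fun p : X × ℝ ↦ chartLoop ι e p.1 1 p.2 - ι p.1) (x₀, t) :=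
      hLc.continuousAt ((e.open_source.prod isOpen_univ).mem_nhds ⟨hx₀, mem_univ _⟩)
    have hLx₀ : Continuous (fun s : ℝ ↦ chartLoop ι e x₀ 1 s - ι x₀) :=
      (continuous_chartLoop hιc he x₀ 1).sub continuous_const
    have hcb : ContinuousAt (fun z : X × ℝ ↦ chartLoop ι e x₀ 1 z.2 - ι x₀) (x₀, t) :=
      hLx₀.continuousAt.comp_of_eq continuous_snd.continuousAt rfl
    have h₁ := hca.tendsto (ball_mem_nhds _ (half_pos hm₀))
    have h₂ := hcb.tendsto (ball_mem_nhds _ (half_pos hm₀))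
    filter_upwards [h₁, h₂] with z hz₁ hz₂
    simp only [mem_preimage, mem_ball] at hz₁ hz₂
    rw [← dist_eq_norm]
    linarith [dist_triangle_right (chartLoop ι e z.1 1 z.2 - ι z.1) (chartLoop ι e x₀ 1 z.2 - ι x₀)
      (chartLoop ι e x₀ 1 t - ι x₀)]
  have hev := isCompact_Icc.eventually_forall_of_forall_eventually
    (P := fun x t ↦ ‖(chartLoop ι e x 1 t - ι x) - (chartLoop ι e x₀ 1 t - ι x₀)‖ <
      ‖chartLoop ι e x₀ 1 t₀ - ι x₀‖) hP
  filter_upwards [hev] with x hx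
  exact wind_eq_of_norm_sub_lt ((continuous_chartLoop hιc he x 1).sub continuous_const).continuousOn
    (by simp only [chartLoop_zero]) hg fun t ht ↦ lt_of_lt_of_le (hx t ht) (hmin ht)

/-- The source of a chart onto the whole model plane is preconnected. [folklore] -/
theorem isPreconnected_source (he : e.target = univ) : IsPreconnected e.source := by
  rw [← e.symm_image_target_eq_source, he]
  have hs : Continuous e.symm := by
    have := e.continuousOn_symm
    rw [he, continuousOn_univ] at this
    exact this
  exact isPreconnected_univ.image _ hs.continuousOn

/-- **The parity is constant on the source of the chart.** [folklore] -/
theorem parity_eq_parity (hιc : Continuous ι) (hι : Injective ι) (he : e.target = univ) {x y : X}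
    (hx : x ∈ e.source) (hy : y ∈ e.source) : parity ι e x = parity ι e y := by
  haveI : PreconnectedSpace e.source := isPreconnected_iff_preconnectedSpace.1 (isPreconnected_source he)
  set g : e.source → ℤ := fun p ↦ parity ι e p with hg
  have hloc : IsLocallyConstant g := by
    refine (IsLocallyConstant.iff_eventually_eq g).2 fun p ↦ ?_
    have h := eventually_parity_eq hιc hι he p.2
    exact continuous_subtype_val.continuousAt.eventually h
  exact hloc.apply_eq_of_preconnectedSpace ⟨x, hx⟩ ⟨y, hy⟩

/-! ## The parity is non-zero -/

/-- Points off the image of the chart have winding number zero with respect to the chart loop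
(shrink the circle to the centre inside the chart). [folklore] -/
theorem wind_chartLoop_sub_eq_zero_of_not_mem (hιc : Continuous ι) (he : e.target = univ) (hx : x ∈ e.source)
    {a : ℂ} (ha : a ∉ ι '' e.source) : wind (fun t ↦ chartLoop ι e x 1 t - a) = 0 := by
  have hne : ∀ z, cplxInv ι e z ≠ a := fun z h ↦ ha (by rw [← range_cplxInv he, ← h]; exact mem_range_self z)
  have h := wind_eq_zero_of_homotopy_const (H := fun s t ↦ chartLoop ι e x (1 - s) t - a) ?_
    (fun s _ ↦ by simp only [chartLoop_zero]) (fun s _ t _ ↦ sub_ne_zero.2 (hne _))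
    (c := ι x - a) fun t ↦ ?_
  · simp only [sub_zero] at h
    exact h
  · refine ContinuousOn.sub ?_ continuousOn_const
    exact continuousOn_chartLoop_comp hιc he continuousOn_const (fun _ _ ↦ hx) (by fun_prop) (by fun_prop)
  · show cplxInv ι e (circleMap (center e x) (1 - 1) (2 * π * t)) - a = ι x - a
    rw [sub_self, circleMap_zero_radius, Function.const_apply, cplxInv_center hx]

/-- **Clopen step in the chart.** Let `U` be an open set of the plane with
`frontier U ⊆ J`, the chart circle about `x`, and `W` a preconnected open set of the model
plane off the unit circle about the centre. If `ψ ⁻¹ U` meets `W` (`ψ` the complexified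
inverse chart) then `W ⊆ ψ ⁻¹ U`: a point of `W` in the closure of `ψ ⁻¹ U` but not in it
would be mapped to `frontier U ⊆ J`, i.e. lie on the circle. [folklore] -/
theorem subset_preimage_of_frontier_subset (hιc : Continuous ι) (hι : Injective ι) (he : e.target = univ)
    {U : Set ℂ} (hUo : IsOpen U) (hUf : frontier U ⊆ range (chartLoop ι e x 1))
    {W : Set ℂ} (hWc : IsPreconnected W)
    (hWJ : ∀ w ∈ W, ‖w - center e x‖ ≠ 1) (hmeet : (W ∩ cplxInv ι e ⁻¹' U).Nonempty) :
    W ⊆ cplxInv ι e ⁻¹' U := by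
  have hψc := continuous_cplxInv hιc he
  have hψi := injective_cplxInv hι he
  -- `ψ ⁻¹ U` is relatively closed in `W`
  have hUo' : IsOpen (cplxInv ι e ⁻¹' U) := hUo.preimage hψc
  have hcl : ∀ w ∈ W, w ∈ closure (cplxInv ι e ⁻¹' U) → w ∈ cplxInv ι e ⁻¹' U := by
    intro w hw hwcl
    by_contra hwU
    have h1 : cplxInv ι e w ∈ closure U := by
      have := image_closure_subset_closure_image hψc (mem_image_of_mem (cplxInv ι e) hwcl)
      exact closure_mono (image_preimage_subset _ U) this
    have h2 : cplxInv ι e w ∈ frontier U := by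
      rw [frontier_eq_closure_inter_closure]
      exact ⟨h1, subset_closure hwU⟩
    obtain ⟨t, ht⟩ := hUf h2
    have h3 : circleLoop (center e x) 1 t = w := hψi ht
    have h4 := norm_circleLoop_sub_center (center e x) 1 t
    rw [h3, abs_one] at h4
    exact hWJ w hw h4
  -- preconnectedness of `W`
  by_contra hnot
  obtain ⟨w₁, hw₁W, hw₁U⟩ := not_subset.1 hnot
  have key := hWc (cplxInv ι e ⁻¹' U) (closure (cplxInv ι e ⁻¹' U))ᶜ hUo' isClosed_closure.isOpen_compl
    (fun w hw ↦ ?_) hmeet ⟨w₁, hw₁W, fun h ↦ hw₁U (hcl w₁ hw₁W h)⟩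
  · obtain ⟨w, -, hwU, hwcl⟩ := key
    exact hwcl (subset_closure hwU)
  · by_cases h : w ∈ cplxInv ι e ⁻¹' U
    · exact Or.inl h
    · exact Or.inr fun h' ↦ h (hcl w hw h')

/-- **The parity of a planar chart is non-zero.** [folklore] -/
theorem parity_ne_zero (hι : IsOpenEmbedding ι) (he : e.target = univ) (hx : x ∈ e.source) :
    parity ι e x ≠ 0 := by
  have hιc := hι.continuous
  have hιi := hι.injective
  have hψc := continuous_cplxInv hιc he
  have hψi := injective_cplxInv hιi he
  have hγc : Continuous (chartLoop ι e x 1) := continuous_chartLoop hιc he x 1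
  have hγp : Function.Periodic (chartLoop ι e x 1) 1 := periodic_chartLoop x 1
  have hγi : InjOn (chartLoop ι e x 1) (Ico 0 1) := injOn_chartLoop hιi he x one_ne_zero
  -- the Jordan curve theorem for the chart loop
  obtain ⟨U, V, hUo, hVo, hUc, -, hUV, hUVeq, hfU, -, hUb, -⟩ :=
    JordanCurveTheorem_holds.of_periodic hγc hγp hγi
  have hJK : IsCompact (range (chartLoop ι e x 1)) :=
    isCompact_of_homeomorphic_addCircle (range_homeomorphic_addCircle hγc hγp hγi)
  -- points of the image circle are the images of the unit circle about the centre
  have hJ_of : ∀ w, ‖w - center e x‖ = 1 → cplxInv ι e w ∈ range (chartLoop ι e x 1) := by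
    intro w hw
    obtain ⟨θ, hθ⟩ := (Complex.norm_eq_one_iff (w - center e x)).1 hw
    refine ⟨θ / (2 * π), ?_⟩
    show cplxInv ι e (circleMap (center e x) 1 (2 * π * (θ / (2 * π)))) = cplxInv ι e w
    rw [show 2 * π * (θ / (2 * π)) = θ by field_simp]
    simp only [circleMap, hθ]
    push_cast
    ring_nf
  have hJ_mem : ∀ w, cplxInv ι e w ∈ range (chartLoop ι e x 1) → ‖w - center e x‖ = 1 := by
    rintro w ⟨t, ht⟩
    have h : circleLoop (center e x) 1 t = w := hψi ht
    rw [← h, norm_circleLoop_sub_center, abs_one]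
  have hUJ : ∀ a ∈ U, a ∉ range (chartLoop ι e x 1) := fun a ha h ↦ by
    have : a ∈ U ∪ V := Or.inl ha
    rw [hUVeq] at this
    exact this h
  -- the component of a point of `U` is inside `U`
  have hUcomp : ∀ a ∈ U, connectedComponentIn (range (chartLoop ι e x 1))ᶜ a ⊆ U := by
    intro a ha
    have hsub : connectedComponentIn (range (chartLoop ι e x 1))ᶜ a ⊆ U ∪ V := by
      rw [hUVeq]
      exact connectedComponentIn_subset _ _
    rcases isPreconnected_connectedComponentIn.subset_or_subset hUo hVo hUV hsub with h | h
    · exact h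
    · exfalso
      have haV : a ∈ V := h (mem_connectedComponentIn (hUJ a ha))
      exact Set.disjoint_left.1 hUV ha haV
  -- points of `U` have non-zero winding number (Eilenberg)
  have hwindU : ∀ a ∈ U, wind (fun t ↦ chartLoop ι e x 1 t - a) ≠ 0 := by
    intro a ha h0
    have hlog := (hasLogOn_sub_range_iff_wind_eq_zero hγc hγp hγi (hUJ a ha)).2 h0
    exact not_hasLogOn_sub hJK (hUJ a ha) (hUb.subset (hUcomp a ha)) hlog
  -- hence `U ⊆ range ψ = ι (e.source)`
  have hUS : U ⊆ range (cplxInv ι e) := by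
    intro a ha
    by_contra haS
    rw [range_cplxInv he] at haS
    exact hwindU a ha (wind_chartLoop_sub_eq_zero_of_not_mem hιc he hx haS)
  -- `U` lies in the image of the open unit disc or of the exterior of the closed unit disc
  set Wi : Set ℂ := ball (center e x) 1 with hWi
  set Wo : Set ℂ := {w | 1 < ‖w - center e x‖} with hWo
  have hWi_o : IsOpen Wi := isOpen_ball
  have hWo_o : IsOpen Wo := isOpen_lt continuous_const (continuous_id.sub continuous_const).norm
  have hU_sub : U ⊆ cplxInv ι e '' Wi ∪ cplxInv ι e '' Wo := by
    intro a ha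
    obtain ⟨w, rfl⟩ := hUS ha
    have hw1 : ‖w - center e x‖ ≠ 1 := fun h1 ↦ hUJ _ ha (hJ_of w h1)
    rcases lt_or_gt_of_ne hw1 with h | h
    · exact Or.inl ⟨w, by rwa [hWi, mem_ball, dist_eq_norm], rfl⟩
    · exact Or.inr ⟨w, h, rfl⟩
  have hdisj : Disjoint (cplxInv ι e '' Wi) (cplxInv ι e '' Wo) := by
    refine Set.disjoint_left.2 ?_
    rintro _ ⟨w, hw, rfl⟩ ⟨w', hw', hww'⟩
    have : w' = w := hψi hww'
    rw [this] at hw'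
    rw [hWi, mem_ball, dist_eq_norm] at hw
    exact lt_asymm hw hw'
  have hopen := isOpenMap_cplxInv hι he
  rcases hUc.isPreconnected.subset_or_subset (hopen Wi hWi_o) (hopen Wo hWo_o) hdisj hU_sub with hUi | hUo'
  · -- `U` inside the image of the disc: then the whole disc is pulled back into `U`
    have hWiU : Wi ⊆ cplxInv ι e ⁻¹' U := by
      refine subset_preimage_of_frontier_subset hιc hιi he hUo hfU.subset (convex_ball _ _).isPreconnected
        (fun w hw ↦ ne_of_lt (by rwa [hWi, mem_ball, dist_eq_norm] at hw)) ?_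
      obtain ⟨a, ha⟩ := hUc.nonempty
      obtain ⟨w, hw, rfl⟩ := hUi ha
      exact ⟨w, hw, ha⟩
    have hxU : ι x ∈ U := by
      rw [← cplxInv_center (ι := ι) hx]
      exact hWiU (mem_ball_self one_pos)
    exact hwindU (ι x) hxU
  · -- `U` inside the image of the exterior: the whole exterior is pulled back into the bounded
    -- `U`, impossible since it leaves every compact of the chart
    exfalso
    have hWo_pre : IsPreconnected Wo := by
      have h := (isConnected_setOf_lt_norm (zero_le_one (α := ℝ))).isPreconnected.image
        (fun z ↦ z + center e x) (by fun_prop)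
      have heq : (fun z ↦ z + center e x) '' {z : ℂ | 1 < ‖z‖} = Wo := by
        ext w
        simp only [mem_image, mem_setOf_eq, hWo]
        constructor
        · rintro ⟨z, hz, rfl⟩; simpa using hz
        · intro hw; exact ⟨w - center e x, hw, by ring⟩
      rwa [heq] at h
    have hWoU : Wo ⊆ cplxInv ι e ⁻¹' U := by
      refine subset_preimage_of_frontier_subset hιc hιi he hUo hfU.subset hWo_pre
        (fun w hw ↦ ne_of_gt hw) ?_
      obtain ⟨a, ha⟩ := hUc.nonempty
      obtain ⟨w, hw, rfl⟩ := hUo' ha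
      exact ⟨w, hw, ha⟩
    -- the sequence `center + (n + 2)` in the exterior
    set q : ℕ → ℂ := fun n ↦ center e x + (((n : ℝ) + 2 : ℝ) : ℂ) with hq
    have hqWo : ∀ n, q n ∈ Wo := fun n ↦ by
      simp only [hWo, hq, mem_setOf_eq, add_sub_cancel_left, Complex.norm_real, Real.norm_eq_abs]
      rw [abs_of_pos (by positivity)]
      linarith
    have hqU : ∀ n, cplxInv ι e (q n) ∈ closure U := fun n ↦ subset_closure (hWoU (hqWo n))
    obtain ⟨z, hz, φ, hφ, hlim⟩ := hUb.isCompact_closure.tendsto_subseq hqU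
    -- the limit is in the chart
    have hzS : z ∈ range (cplxInv ι e) := by
      rw [closure_eq_self_union_frontier] at hz
      rcases hz with hz | hz
      · exact hUS hz
      · obtain ⟨t, rfl⟩ := hfU.subset hz
        exact ⟨_, rfl⟩
    obtain ⟨w, rfl⟩ := hzS
    -- pull back the convergence through the embedding `ι` and the chart `e`
    have h1 : Tendsto (fun n ↦ e.symm (toRR (q (φ n)))) atTop (𝓝 (e.symm (toRR w))) := by
      rw [hι.isEmbedding.tendsto_nhds_iff]
      exact hlim
    have hsrc : e.symm (toRR w) ∈ e.source := e.map_target (by rw [he]; exact mem_univ _)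
    have h2 : Tendsto (fun n ↦ e (e.symm (toRR (q (φ n))))) atTop (𝓝 (e (e.symm (toRR w)))) :=
      (e.continuousAt hsrc).tendsto.comp h1
    have heq : ∀ p : ℝ × ℝ, e (e.symm p) = p := fun p ↦ e.right_inv (by rw [he]; exact mem_univ _)
    simp only [heq] at h2
    have h3 : Tendsto (fun n ↦ (toRR (q (φ n))).1) atTop (𝓝 (toRR w).1) :=
      (continuous_fst.tendsto _).comp h2
    have h4 : ∀ n, (toRR (q (φ n))).1 = (center e x).re + ((φ n : ℝ) + 2) := fun n ↦ by
      simp [hq, toRR_apply]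
    simp only [h4] at h3
    have h5 : Tendsto (fun n ↦ (center e x).re + ((φ n : ℝ) + 2)) atTop atTop := by
      refine tendsto_atTop_add_const_left _ _ ?_
      refine tendsto_atTop_add_const_right _ _ ?_
      exact tendsto_natCast_atTop_atTop.comp hφ.tendsto_atTop
    exact not_tendsto_nhds_of_tendsto_atTop h5 _ h3

end Parity

end Literature.Topology.PlaneTopology
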